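import Summits.QuantumFields.YangMills.Theorems.BalabanUVNodesN09CentralWindowJacobianGraphContinuous
import Literature.MathematicalPhysics.QuantumFieldTheory.Balaban1983to89.T3ContinuumYM3Torus
import HarnessLib

/-!
# LINE g18-2 «wreg_chart» (20520 organ WREG) — stub VOL `ChartVolT3` is a theorem: uniform volume non-compression of the one-step (0.4)
average on the central `α`-windows of a fixed three-torus `F.P K`, `G = SU(2)`

Cell `ym3-torus`, width seat `ym3-torus-px17` g6 (helper of `stmt-QuantumFields-20520` = `UnitScaleTilt.FluctuationComparisonRegPrIntL`,
`--supports`, count-neutral).  Theorems-side twin of the chart-free stub `stub_chartVol : ChartVolT3` of the ideator seat ym-r3-idea-1 g18's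
`Cruxes/FluctuationComparisonRegPrIntL/Lines/wreg_chart.lean` (v14, :1943 with `ChainVol` :395 and `centralWindowSet` :207 unfolded to their bodies —
`Cruxes.*` is not importable under `Theorems/`).

WHY IT HOLDS (the ideator's own remark «⇐ CHART-CONT», with CHART-CONT a tree theorem since 2026-08-28): pub-ymgap dag-n09-w6's
`…N09CentralWindowJacobianGraphContinuous.exists_jacobian_forwardLaws_continuousOn_graph` exports, for every level `j + 1 ≤ m + K` of a generic torus
`P` and every coarse bond `c`, a Jacobian `jac c U g` of the one-variable average `g ↦ Ū(U[β(c) ↦ g])(c)` with (i) the forward law on the closed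
`α`-window `Ωα(U,c)` — `Haar⌊(f '' Ωα) = f_* ((Haar⌊Ωα)·jac)` — (ii) `jac ≠ 0` on the window and (iii) JOINT continuity on the compact window graph;
dag-n09-w5's `exists_pos_le_density_of_continuousOn_graph` turns (ii)+(iii) into a positive lower bound `m(j,c) ≤ jac` uniform in `(U, g)`; the finite
minimum over `j < m + K`, `c : PBond` is `j₀ > 0`; and for measurable `A ⊆ Ωα(U,c)`:
`j₀·Haar A ≤ ∫⁻_A jac dHaar = ((Haar⌊Ωα)·jac) A ≤ ((Haar⌊Ωα)·jac) (f⁻¹(f '' A)) ≤ (f_*((Haar⌊Ωα)·jac)) (f '' A) = Haar⌊(f '' Ωα) (f '' A) ≤ Haar (f '' A)`.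

HONEST FRAMING.  Kernel bookkeeping over landed N09 calculus (joint continuity + compactness + one change of variables); nothing of Bałaban's is
asserted; the smallness ∕ gap numerics on `α` stay DISPLAYED hypotheses exactly as in the stub; WREG, S2β, the organ, `FluctuationComparisonRegPrIntL`
(20520) and every other crux are NOT proved; rung R3 = YM₃ on T³ — NOT d = 4, NOT infinite volume, NOT a mass gap, NOT Clay.
-/

noncomputable section

open MeasureTheory Set Function Filter Topology
open scoped ENNReal NNReal
open Literature.MathematicalPhysics.QuantumFieldTheory.Balaban1983to89
open Literature.MathematicalPhysics.QuantumFieldTheory.Balaban1983to89.T3ContinuumYM3Torus (T3Family)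
open Literature.MathematicalPhysics.QuantumFieldTheory.Balaban1983to89.Node00 (SU)
open Literature.MathematicalPhysics.QuantumFieldTheory.Balaban1983to89.ExpMeanLog (expMeanLogSU deltaSU)
open Literature.MathematicalPhysics.QuantumFieldTheory.Balaban1983to89.BlockAveraging (Idx avgFun)
open Literature.MathematicalPhysics.QuantumFieldTheory.Balaban1983to89.BlockAveragingHaarAC (centralBond pre post)
open Literature.MathematicalPhysics.QuantumFieldTheory.Balaban1983to89.BlockAveragingEMLHaarAC (fibreFamily offCard)
open Summit.QuantumFields.YangMills.BalabanUVNodes.N09CentralWindowJacobianGraphContinuous (exists_jacobian_forwardLaws_continuousOn_graph)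
open Summit.QuantumFields.YangMills.BalabanUVNodes.N09TowerOfPerBondChartsOfWindowOpenness (exists_pos_le_density_of_continuousOn_graph)

namespace Summit.QuantumFields.YangMills.Theorems.FluctuationComparisonRegPrIntLWregChartVol

/-- ★★ **VOL `ChartVolT3` (LINE g18-2 `wreg_chart.lean` :1943, text verbatim with `ChainVol`∕`centralWindowSet` unfolded)**: on a fixed three-torus
`F.P K` with `G = SU(2)`, in the chart regime `0 < α ≤ 1∕24`, `64·α ≤ δ_SU(2)`, `157·α < L^{−(d−1)}`, `offCard c∕|Idx| + 150·α < 1`, there is ONE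
`j₀ > 0` such that for every level `j + 1 ≤ m + K`, environment `W`, coarse bond `c` and measurable `A` inside the central `α`-window of `(W, c)`:
`j₀ · Haar A ≤ Haar (Ū′(c) '' A)` for the one-variable (0.4) average `Ū′(c) : g ↦ Ū(W[β(c) ↦ g])(c)`.
[cite: Balaban1987RG1, (0.4) p.253 and (2.10) p.267; Helgason2000, Ch. I §1 Thm. 1.14 (12)-(13) p. 96] -/
theorem chartVolT3_holds :
    ∀ (F : T3Family) (K : ℕ) (α : ℝ), 0 < α → α ≤ 1 / 24 → 64 * α ≤ deltaSU (Fin 2) →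
      157 * α < (((F.P K).L : ℝ) ^ ((F.P K).d - 1))⁻¹ →
      (∀ j (c : PBond (F.P K) (j + 1)), (offCard c : ℝ) / (Fintype.card (Idx (F.P K)) : ℝ) + 150 * α < 1) →
        ∃ j₀ : ℝ≥0, 0 < j₀ ∧
          ∀ (j : ℕ), j + 1 ≤ (F.P K).m + (F.P K).K →
            ∀ (W : GaugeField (F.P K) j (SU 2)) (c : PBond (F.P K) (j + 1)) (A : Set (SU 2)), MeasurableSet A →
              A ⊆ {h : SU 2 | ∀ i : Idx (F.P K), dist1 (fibreFamily W c (pre W c * h * post W c) i) ≤ α} →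
                (j₀ : ℝ≥0∞) * (HaarData.haar : Measure (SU 2)) A ≤
                  (HaarData.haar : Measure (SU 2))
                    ((fun g : SU 2 => avgFun (expMeanLogSU (n := Fin 2)) (update W (centralBond c) g) c) '' A) := by
  intro F K α hα0 hα24 hα64 hαL hgap
  classical
  -- §1  per level `j` and coarse bond `c`: a positive constant `m(j,c)` with `m·Haar A ≤ Haar (f '' A)` on the window (N09 letters)
  have hlev : ∀ (j : ℕ) (c : PBond (F.P K) (j + 1)), ∃ m : ℝ≥0, 0 < m ∧
      (j + 1 ≤ (F.P K).m + (F.P K).K →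
        ∀ (W : GaugeField (F.P K) j (SU 2)) (A : Set (SU 2)), MeasurableSet A →
          A ⊆ {h : SU 2 | ∀ i : Idx (F.P K), dist1 (fibreFamily W c (pre W c * h * post W c) i) ≤ α} →
            (m : ℝ≥0∞) * (HaarData.haar : Measure (SU 2)) A ≤
              (HaarData.haar : Measure (SU 2))
                ((fun g : SU 2 => avgFun (expMeanLogSU (n := Fin 2)) (update W (centralBond c) g) c) '' A)) := by
    intro j c
    by_cases hj : j + 1 ≤ (F.P K).m + (F.P K).K
    swap
    · exact ⟨1, one_pos, fun h => absurd h hj⟩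
    obtain ⟨jac, -, hjac0, hfwd, -, hjacc⟩ :=
      exists_jacobian_forwardLaws_continuousOn_graph (N := 2) (P := F.P K) hj hα0.le hα24 hα64 hαL (hgap j)
    obtain ⟨m, hm0, hm⟩ := exists_pos_le_density_of_continuousOn_graph c α (jac c) (hjacc c) (hjac0 c)
    refine ⟨m, hm0, fun _ W A hA hAΩ => ?_⟩
    have hlaw := hfwd c W
    set Ω : Set (SU 2) := {h : SU 2 | ∀ i : Idx (F.P K), dist1 (fibreFamily W c (pre W c * h * post W c) i) ≤ α} with hΩ
    set f : SU 2 → SU 2 := fun g : SU 2 => avgFun (expMeanLogSU (n := Fin 2)) (update W (centralBond c) g) c with hf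
    have hAv : Measurable (avgFun (expMeanLogSU (n := Fin 2)) :
        GaugeField (F.P K) j (SU 2) → GaugeField (F.P K) (j + 1) (SU 2)) :=
      BlockAveraging.measurable_avgFun _ ExpMeanLog.measurable_expMeanLogSU_E
    have hfm : Measurable f := (measurable_pi_apply c).comp (hAv.comp (measurable_update W))
    have hAΩ' : A ∩ Ω = A := inter_eq_left.2 hAΩ
    calc (m : ℝ≥0∞) * (HaarData.haar : Measure (SU 2)) A
        = ∫⁻ _ in A, (m : ℝ≥0∞) ∂(HaarData.haar : Measure (SU 2)) := (setLIntegral_const A (m : ℝ≥0∞)).symm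
      _ ≤ ∫⁻ g in A, (jac c W g : ℝ≥0∞) ∂(HaarData.haar : Measure (SU 2)) :=
          setLIntegral_mono' hA fun g hg => ENNReal.coe_le_coe.2 (hm W g (hAΩ hg))
      _ = (((HaarData.haar : Measure (SU 2)).restrict Ω).withDensity fun g => (jac c W g : ℝ≥0∞)) A := by
          rw [withDensity_apply _ hA, Measure.restrict_restrict hA, hAΩ']
      _ ≤ (((HaarData.haar : Measure (SU 2)).restrict Ω).withDensity fun g => (jac c W g : ℝ≥0∞)) (f ⁻¹' (f '' A)) :=
          measure_mono (subset_preimage_image f A)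
      _ ≤ ((((HaarData.haar : Measure (SU 2)).restrict Ω).withDensity fun g => (jac c W g : ℝ≥0∞)).map f) (f '' A) :=
          Measure.le_map_apply hfm.aemeasurable _
      _ = ((HaarData.haar : Measure (SU 2)).restrict (f '' Ω)) (f '' A) := by rw [hlaw]
      _ ≤ (HaarData.haar : Measure (SU 2)) (f '' A) := Measure.le_iff'.1 Measure.restrict_le_self _
  -- §2  one `j₀ > 0` below every `m(j,c)`, `j < m + K` (finite minimum)
  choose m hm0 hmle using hlev
  set B : ℕ := (F.P K).m + (F.P K).K with hB
  let ι : Type := Σ j : Fin B, PBond (F.P K) ((j : ℕ) + 1)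
  let μ : ι → ℝ≥0 := fun x => m (x.1 : ℕ) x.2
  by_cases hne : (Finset.univ : Finset ι).Nonempty
  · refine ⟨Finset.univ.inf' hne μ, (Finset.lt_inf'_iff hne).2 fun x _ => hm0 _ _, fun j hj W c A hA hAΩ => ?_⟩
    have hjB : j < B := by omega
    have hle : Finset.univ.inf' hne μ ≤ m j c :=
      Finset.inf'_le μ (Finset.mem_univ (⟨⟨j, hjB⟩, c⟩ : ι))
    calc ((Finset.univ.inf' hne μ : ℝ≥0) : ℝ≥0∞) * (HaarData.haar : Measure (SU 2)) A
        ≤ (m j c : ℝ≥0∞) * (HaarData.haar : Measure (SU 2)) A := by gcongr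
      _ ≤ _ := hmle j c hj W A hA hAΩ
  · refine ⟨1, one_pos, fun j hj W c A hA hAΩ => ?_⟩
    have hjB : j < B := by omega
    exact absurd ⟨(⟨⟨j, hjB⟩, c⟩ : ι), Finset.mem_univ _⟩ hne

end Summit.QuantumFields.YangMills.Theorems.FluctuationComparisonRegPrIntLWregChartVol

end
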